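import Literature.Analysis.SegalBargmann.SchwartzUnitaryIdentification
import Literature.Analysis.SegalBargmann.FockDualPairCompact
import HarnessLib

/-!
# Covariant Schwartz-level families on the compact dual pair `(U(P)×U(Q)) × (U(R)×U(S))`: weights and continuity on `𝓢` (Folland 1989, Prop. (4.39); Kashiwara–Vergne 1978)

Topic `Analysis/SegalBargmann`; namespace `Literature.Analysis.SegalBargmann`.  The dual-pair file `FockDualPairCompact`
(block datum `dualPairι : (U(P)×U(Q))×(U(R)×U(S)) →* U(DPIdx P Q R S)`, torus `dualPairι_diagHom`, polynomial weights
`torusChar_dpTorus`, `torusChar_dpTorus_scalarW/V`) states its weight theorem for unitary families on `L²`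
(`IsRhoCovariant.apply_hermiteL2_dualPair_torus`).  This file is its SCHWARTZ-LEVEL form, through
`SchwartzTorusIdentification` / `SchwartzUnitaryIdentification`: for ANY family `ωS` of linear operators on
`𝓢(ℝ^{DPIdx}, ℂ)` that is Heisenberg-covariant through `dualPairι` and lifts to unitaries `ω`,

* `IsRhoCovariantS.apply_eq_vacCoeff_smul_unitaryOpPi_dualPair`: `ωS k = vacCoeff ω k • μ₀(dualPairι k)` on ALL of `𝓢`;
* `IsRhoCovariantS.apply_hermitePi_dualPair_torus`: on the torus `k = (diag α, diag β, diag γ, diag δ)` the Hermite function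
  `h_m ∈ 𝓢` is a weight vector with weight `vacCoeff ω k · torusChar m (dpTorus α β γ δ)`;
* `IsRhoCovariantS.apply_hermitePi_dualPair_scalarW/_scalarV`: the centre `t·1` of `U(W)` (resp. `U(V)`) acts on `h_m` by
  `vacCoeff · t^{deg_{PR} m + deg_{QS} m} · t̄^{deg_{PS} m + deg_{QR} m}`;
* `IsRhoCovariantS.apply_hermitePi_zero_dualPair`: the Gaussian is an eigenvector with eigenvalue `vacCoeff ω k`;
* `IsRhoCovariantS.continuous_apply_dualPair/_uncurry_dualPair`: the orbit maps `k ↦ ωS k f` are continuous into the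
  SCHWARTZ topology as soon as the vacuum expectation is (`dualPairι` is continuous, tree `continuous_dualPairι`).

Everything is a composition of landed tree theorems; no cited statement is used as a hypothesis.  Use (pub-hodgecm
model cell): at a place where both members of PerL's dual pair are compact the whole archimedean Weil operator family
on the Schwartz space is covered; elsewhere its `K × K′`-restriction is.

## References

* [Folland1989] G. B. Folland, *Harmonic Analysis in Phase Space*, Princeton UP (1989), Prop. (4.39), §1.7.
  [cite: Folland1989, Prop (4.39)]
* M. Kashiwara, M. Vergne, *On the Segal–Shale–Weil representations and harmonic polynomials*, Invent. Math. 44 (1978)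
  (the `K×K′`-weights of the Fock model).

## Provenance

LEAN-IN-TREE rule (2026-08-18), pub-hodgecm model-construction sub-cell, seat mc-binder-2 gen 2 (rows A12/A34; (W-wt)
consumers of the theta lanes).
-/

set_option autoImplicit false

noncomputable section

open MeasureTheory Complex SchwartzMap Filter Topology
open scoped InnerProductSpace ComplexConjugate Real BigOperators

namespace Literature.Analysis.SegalBargmann

variable {P Q R S : Type*} [Fintype P] [DecidableEq P] [Fintype Q] [DecidableEq Q] [Fintype R] [DecidableEq R]
  [Fintype S] [DecidableEq S]

local notation "L2D" => Lp ℂ 2 (volume : Measure (DPIdx P Q R S → ℝ))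
local notation "SD" => SchwartzMap (DPIdx P Q R S → ℝ) ℂ

variable {ωS : DPK P Q R S → ((SchwartzMap (DPIdx P Q R S → ℝ) ℂ) →ₗ[ℂ] SchwartzMap (DPIdx P Q R S → ℝ) ℂ)}
  {ω : DPK P Q R S → ((Lp ℂ 2 (volume : Measure (DPIdx P Q R S → ℝ))) ≃ₗᵢ[ℂ]
    Lp ℂ 2 (volume : Measure (DPIdx P Q R S → ℝ)))}

/-- **Rigidity on `𝓢` for the compact dual pair**: `ωS k f = vacCoeff ω k • μ₀(dualPairι k) f` for every
`k ∈ (U(P)×U(Q))×(U(R)×U(S))` and every Schwartz `f`. [cite: Folland1989, Prop (4.39)] -/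
theorem IsRhoCovariantS.apply_eq_vacCoeff_smul_unitaryOpPi_dualPair
    (hS : IsRhoCovariantS (fun k : DPK P Q R S => dualPairι k) ωS) (hlift : ∀ k, LiftsTo (ωS k) (liftCLM ω k))
    (k : DPK P Q R S) (f : SD) : ωS k f = vacCoeff ω k • unitaryOpPi (dualPairι k) f :=
  hS.apply_eq_vacCoeff_smul_unitaryOpPi hlift k f

/-- **Weights on the dual-pair torus, Schwartz level**: for `k = (diag α, diag β, diag γ, diag δ)` the Hermite function
`h_m ∈ 𝓢(ℝ^{DPIdx})` is a weight vector of `ωS k` with weight `vacCoeff ω k · torusChar m (dpTorus α β γ δ)`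
(tree `torusChar_dpTorus`: positive degrees on the same-sign blocks, conjugate on the mixed blocks). [cite: Folland1989, Prop (4.39)] -/
theorem IsRhoCovariantS.apply_hermitePi_dualPair_torus
    (hS : IsRhoCovariantS (fun k : DPK P Q R S => dualPairι k) ωS) (hlift : ∀ k, LiftsTo (ωS k) (liftCLM ω k))
    (α : P → Circle) (β : Q → Circle) (γ : R → Circle) (δ : S → Circle) (m : DPIdx P Q R S →₀ ℕ) :
    ωS ((diagHom α, diagHom β), (diagHom γ, diagHom δ)) (hermitePi m) =
      (vacCoeff ω ((diagHom α, diagHom β), (diagHom γ, diagHom δ)) * torusChar m (dpTorus α β γ δ)) •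
        hermitePi m :=
  hS.apply_hermitePi_of_diag hlift (dualPairι_diagHom α β γ δ) m

/-- **The centre of `U(W)`** (`a = b = 1`, `c = t·1_R`, `d = t·1_S`) acts on `h_m ∈ 𝓢` by
`vacCoeff · t^{deg_{PR} m + deg_{QS} m} · t̄^{deg_{PS} m + deg_{QR} m}`. [cite: Folland1989, Prop (4.39)] -/
theorem IsRhoCovariantS.apply_hermitePi_dualPair_scalarW
    (hS : IsRhoCovariantS (fun k : DPK P Q R S => dualPairι k) ωS) (hlift : ∀ k, LiftsTo (ωS k) (liftCLM ω k))
    (t : Circle) (m : DPIdx P Q R S →₀ ℕ) :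
    ωS ((diagHom fun _ : P => (1 : Circle), diagHom fun _ : Q => (1 : Circle)),
        (diagHom fun _ : R => t, diagHom fun _ : S => t)) (hermitePi m) =
      (vacCoeff ω ((diagHom fun _ : P => (1 : Circle), diagHom fun _ : Q => (1 : Circle)),
          (diagHom fun _ : R => t, diagHom fun _ : S => t)) *
        (((t : Circle) : ℂ) ^ (degPR m + degQS m) * conj ((t : Circle) : ℂ) ^ (degPS m + degQR m))) •
        hermitePi m := by
  rw [hS.apply_hermitePi_dualPair_torus hlift, torusChar_dpTorus_scalarW]

/-- **The centre of `U(V)`** (`a = t·1_P`, `b = t·1_Q`, `c = d = 1`) acts on `h_m ∈ 𝓢` by the same weight.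
[cite: Folland1989, Prop (4.39)] -/
theorem IsRhoCovariantS.apply_hermitePi_dualPair_scalarV
    (hS : IsRhoCovariantS (fun k : DPK P Q R S => dualPairι k) ωS) (hlift : ∀ k, LiftsTo (ωS k) (liftCLM ω k))
    (t : Circle) (m : DPIdx P Q R S →₀ ℕ) :
    ωS ((diagHom fun _ : P => t, diagHom fun _ : Q => t),
        (diagHom fun _ : R => (1 : Circle), diagHom fun _ : S => (1 : Circle))) (hermitePi m) =
      (vacCoeff ω ((diagHom fun _ : P => t, diagHom fun _ : Q => t),
          (diagHom fun _ : R => (1 : Circle), diagHom fun _ : S => (1 : Circle))) *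
        (((t : Circle) : ℂ) ^ (degPR m + degQS m) * conj ((t : Circle) : ℂ) ^ (degPS m + degQR m))) •
        hermitePi m := by
  rw [hS.apply_hermitePi_dualPair_torus hlift, torusChar_dpTorus_scalarV]

/-- **The Gaussian is an eigenvector of every `ωS k`, with eigenvalue the vacuum expectation.**
[cite: Folland1989, Prop (4.39)] -/
theorem IsRhoCovariantS.apply_hermitePi_zero_dualPair
    (hS : IsRhoCovariantS (fun k : DPK P Q R S => dualPairι k) ωS) (hlift : ∀ k, LiftsTo (ωS k) (liftCLM ω k))
    (k : DPK P Q R S) : ωS k (hermitePi 0) = vacCoeff ω k • hermitePi 0 :=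
  hS.apply_hermitePi_zero hlift k

/-- **Continuity of the orbit maps in the Schwartz topology** on the compact dual pair: `k ↦ ωS k f` is continuous for
every `f ∈ 𝓢` as soon as the vacuum expectation `k ↦ ⟨k_0, ω k k_0⟩` is (`dualPairι` is continuous).
[cite: Folland1989, Prop (4.39)] -/
theorem IsRhoCovariantS.continuous_apply_dualPair
    (hS : IsRhoCovariantS (fun k : DPK P Q R S => dualPairι k) ωS) (hlift : ∀ k, LiftsTo (ωS k) (liftCLM ω k))
    (hvac : Continuous (vacCoeff ω)) (f : SD) : Continuous fun k => ωS k f :=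
  hS.continuous_apply hlift continuous_dualPairι hvac f

/-- Joint continuity `(k, f) ↦ ωS k f` on `((U(P)×U(Q))×(U(R)×U(S))) × 𝓢`. [cite: Folland1989, Prop (4.39)] -/
theorem IsRhoCovariantS.continuous_uncurry_dualPair
    (hS : IsRhoCovariantS (fun k : DPK P Q R S => dualPairι k) ωS) (hlift : ∀ k, LiftsTo (ωS k) (liftCLM ω k))
    (hvac : Continuous (vacCoeff ω)) : Continuous fun p : DPK P Q R S × SD => ωS p.1 p.2 :=
  hS.continuous_uncurry hlift continuous_dualPairι hvac

/-- The vacuum expectation is continuous when the vacuum orbit `k ↦ ω k k_0` is; then so are all orbit maps on `𝓢`.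
[cite: Folland1989, Prop (4.39)] -/
theorem IsRhoCovariantS.continuous_apply_dualPair_of_vacOrbit
    (hS : IsRhoCovariantS (fun k : DPK P Q R S => dualPairι k) ωS) (hlift : ∀ k, LiftsTo (ωS k) (liftCLM ω k))
    (hc : Continuous fun k => ω k (vacL2 : L2D)) (f : SD) : Continuous fun k => ωS k f :=
  hS.continuous_apply_dualPair hlift (continuous_vacCoeff hc) f

end Literature.Analysis.SegalBargmann
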